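import Literature.AlgebraicGeometry.Motives.WeilFormIsotropicBlockVectors
import HarnessLib

/-!
# Isotropic coefficient vectors for the block Gram matrix of `A × (E₀ × E₀)`, in all cases

Layer `Literature/AlgebraicGeometry/Motives`, companion of `Motives/WeilFormIsotropicBlockVectors`
(`exists_isotropic_blockVectors`: the isotropic vectors for the block Gram matrix of `A × (E₀ × E₀)`
in the GENERIC case `κ₁ ≠ 0`, `κ₂ ≠ 0`, `r₀ = G_E(v₀, M_E v₀) ≠ 0` — the weights `κ₁ ∝ d_E²`,
`κ₂ ∝ d_A` are top self-intersections of polarization classes, `r₀` the cup-product pairing on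
`H¹(E₀)`). To spare the final assembly of the partner-surface lemma (Markman, arXiv:2509.23403 §11.5
Step 2; van Geemen, LNM 1594, Lemma 5.2 (3), 5.3, 5.4; Schoen, Compositio 114 (1998) §10) any
non-vanishing facts about these numbers, this file handles the DEGENERATE cases too, where some Gram
blocks vanish and Lagrangians come for free:

* `exists_blockVectors_of_isotropicSubmodule` — the transport lemma, factored out of
  `exists_isotropic_blockVectors`: ANY `K`-subspace `L ⊆ V × K²` of `K`-dimension `n + 1` which is
  isotropic for `κ₁·E_A ⊕ κ₂ r₀·(m₁ W ⊕ -m₂ W)` (`W(k, k') = re k · im k' - im k · re k'`) yields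
  `2n + 2` `ℚ`-independent, `(M_A ⊕ M_E ⊕ -M_E)`-stable vectors isotropic for the block Gram matrix
  `fromBlocks ((κ₁ m₁ m₂)·G_A) 0 0 (fromBlocks ((κ₂ m₂)·G_E) 0 0 ((κ₂ m₁)·G_E))`; injectivity of the
  transport only needs `v₀ ≠ 0` (`M_E` has no rational eigenvector, `M_E² = -d < 0`:
  `eq_zero_of_binaryTransport_eq_zero'`);
* `exists_isotropic_blockVectors'` — **the conclusion of `exists_isotropic_blockVectors` for ALL
  `κ₁, κ₂, r₀`** (only `v₀ ≠ 0`): generic case = that theorem; if `κ₂ r₀ = 0` the partner blocks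
  vanish and `L = L_A × K²` with `L_A` a totally isotropic `(n-1)`-space of `(V_A, E_A)` (Witt index
  `≥ n - 1` for signature `(n, n)`: the tree's `Motives.exists_weil_presplitting`, van Geemen 5.4
  via Meyer); if `κ₁ = 0` the `A`-block vanishes and `L = P × Δ_K` (`P` a positive `n`-space, `Δ_K`
  the diagonal line of `K²`, isotropic for `W ⊕ -W`), with `m₁ = m₂ = 1`.

Provenance: first landed on the summit side (route `HeckePrymWeil` of the Hodge summit, file
`Theorems/HeckePrymWeilAimedDescendingIsotropicGlueAll`, same statements and proofs); re-hosted here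
because the facts that need it (`HodgeTheory.exists_weilTypeSurface_prod_isHyperbolicWeilType_all`,
`Motives.exists_cmWeilSurface_aimedSplitProduct_of_ne_one_of_ne_three`) are Literature facts, whose
discharges cannot import `Summits` (CONVENTIONS §2). Everything is proved; no definition and no
named fact is introduced.

## References

* [vanGeemen1994HodgeAV] B. van Geemen, An introduction to the Hodge conjecture for abelian
  varieties, LNM 1594 (1994), Lemma 5.2 (2)–(4), 5.3, 5.4 (5.4.1).
* [Schoen1998HodgeWeilAddendum] C. Schoen, Compositio Math. 114 (1998), §10.
* [Markman2025SurveySecant] E. Markman, arXiv:2509.23403, §11.5 Step 2.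
-/

noncomputable section

open Module

namespace Literature.AlgebraicGeometry.Motives

section Transport

variable {K : Type} [Field K] [Algebra ℚ K] {α : K} {d : ℚ} (hd : 0 < d)
  (hα : α * α = algebraMap ℚ K (-d))
  (hK : ∀ k : K, ∃ a b : ℚ, k = algebraMap ℚ K a + algebraMap ℚ K b * α)

include hd in
/-- **`M_E` has no rational eigenvector** (`M_E² = -d`, `d > 0`): if `a v + b M_E v = 0` with `v ≠ 0`
then `a = b = 0`; in the transport form, `re k · v + ε im k · M_E v = 0`, `ε ≠ 0` forces `k = 0`.
[folklore] -/
theorem eq_zero_of_binaryTransport_eq_zero' {ME : Matrix (Fin 2) (Fin 2) ℚ}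
    (hME : ∀ w, ME.mulVec (ME.mulVec w) = -(d • w)) {v : Fin 2 → ℚ} (hv : v ≠ 0) (ε : ℚ) (hε : ε ≠ 0)
    {k : K} (hk : reCoord hd hα hK k • v + (ε * imCoord hd hα hK k) • ME.mulVec v = 0) : k = 0 := by
  set a := reCoord hd hα hK k with ha
  set b := ε * imCoord hd hα hK k with hb
  -- apply `M_E`: `a M v - b d v = 0`; combine with `a v + b M v = 0` to kill `M v`
  have h2 := congrArg ME.mulVec hk
  rw [Matrix.mulVec_add, Matrix.mulVec_smul, Matrix.mulVec_smul, hME, Matrix.mulVec_zero] at h2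
  have h3 : ∀ i, (a * a + b * b * d) * v i = 0 := fun i => by
    have e1 := congrFun hk i
    have e2 := congrFun h2 i
    simp only [Pi.add_apply, Pi.smul_apply, Pi.neg_apply, Pi.zero_apply, smul_eq_mul] at e1 e2
    linear_combination a * e1 - b * e2
  obtain ⟨i, hi⟩ : ∃ i, v i ≠ 0 := Function.ne_iff.mp hv
  have hab : a * a + b * b * d = 0 := (mul_eq_zero.1 (h3 i)).resolve_right hi
  have hbd : 0 ≤ b * b * d := mul_nonneg (mul_self_nonneg b) hd.le
  have haa : a * a = 0 := by nlinarith [mul_self_nonneg a]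
  have ha0 : a = 0 := mul_self_eq_zero.1 haa
  have hbb : b * b = 0 := by
    have h : b * b * d = 0 := by linarith
    exact (mul_eq_zero.1 h).resolve_right hd.ne'
  have hb0 : b = 0 := mul_self_eq_zero.1 hbb
  have hb0' : imCoord hd hα hK k = 0 := by
    rcases mul_eq_zero.1 (hb ▸ hb0 : ε * imCoord hd hα hK k = 0) with h | h
    · exact absurd h hε
    · exact h
  rw [eq_reCoord_add_imCoord hd hα hK k, ← ha, ha0, hb0']
  simp

variable {ιA : Type} [Fintype ιA] [DecidableEq ιA] [Module K (ιA → ℚ)] [IsScalarTower ℚ K (ιA → ℚ)]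

omit [DecidableEq ιA] [IsScalarTower ℚ K (ιA → ℚ)] in
include hd hα hK in
/-- **The transport lemma.** Let `V = ι_A → ℚ` carry a compatible `K`-structure with `α` acting as
`M_A`, let `(M_E, G_E)` be the binary partner (`M_E² = -d`, `G_E` alternating), `v₀ ≠ 0`,
`r₀ = G_E(v₀, M_E v₀)`, `m₁, m₂ > 0`, `κ₁, κ₂ ∈ ℚ`. Every `K`-subspace `L ⊆ V × K²` of dimension
`n + 1` on which `κ₁ G_A(x₁, y₁) + κ₂ r₀ (m₁ W(x₂₀, y₂₀) - m₂ W(x₂₁, y₂₁))` vanishes identically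
(`W(k, k') = re k im k' - im k re k'`) is transported by
`Θ(v, k₀, k₁) = (v, m₁ θ₊(k₀), m₂ θ₋(k₁))` to `2n + 2` `ℚ`-independent vectors of
`(ι_A ⊕ (Fin 2 ⊕ Fin 2)) → ℚ` spanning an `(M_A ⊕ M_E ⊕ -M_E)`-stable subspace, totally isotropic
for `fromBlocks ((κ₁ m₁ m₂)·G_A) 0 0 (fromBlocks ((κ₂ m₂)·G_E) 0 0 ((κ₂ m₁)·G_E))` (the map is
`ℚ`-linear, injective, `α`-equivariant and pulls the Gram matrix back to `m₁ m₂` times the displayed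
form; file XI, made uniform). [cite: vanGeemen1994HodgeAV, Lemma 5.2 (3), 5.3 and 5.4 (5.4.1)] -/
theorem exists_blockVectors_of_isotropicSubmodule (MA GA : Matrix ιA ιA ℚ)
    (hαM : ∀ v : ιA → ℚ, α • v = MA.mulVec v)
    (ME GE : Matrix (Fin 2) (Fin 2) ℚ) (hME : ∀ v, ME.mulVec (ME.mulVec v) = -(d • v))
    (hGEt : ∀ x y : Fin 2 → ℚ, y ⬝ᵥ GE.mulVec x = -(x ⬝ᵥ GE.mulVec y)) {v₀ : Fin 2 → ℚ} (hv₀ : v₀ ≠ 0)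
    {m₁ m₂ : ℕ} (hm₁ : 0 < m₁) (hm₂ : 0 < m₂) (κ₁ κ₂ : ℚ) (n : ℕ)
    (L : Submodule K ((ιA → ℚ) × (Fin 2 → K))) [Module.Finite ℚ (L.restrictScalars ℚ)]
    (hL : Module.finrank ℚ (L.restrictScalars ℚ) = 2 * (n + 1))
    (hiso : ∀ x ∈ L, ∀ y ∈ L, κ₁ * (x.1 ⬝ᵥ GA.mulVec y.1) + κ₂ * (v₀ ⬝ᵥ GE.mulVec (ME.mulVec v₀)) *
      ((m₁ : ℚ) * (reCoord hd hα hK (x.2 0) * imCoord hd hα hK (y.2 0) -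
          imCoord hd hα hK (x.2 0) * reCoord hd hα hK (y.2 0)) -
        (m₂ : ℚ) * (reCoord hd hα hK (x.2 1) * imCoord hd hα hK (y.2 1) -
          imCoord hd hα hK (x.2 1) * reCoord hd hα hK (y.2 1))) = 0) :
    ∃ b : Fin (2 * (n + 1)) → (ιA ⊕ (Fin 2 ⊕ Fin 2)) → ℚ, LinearIndependent ℚ b ∧
      (∀ k, ∃ c : Fin (2 * (n + 1)) → ℚ,
        (Matrix.fromBlocks MA 0 0 (Matrix.fromBlocks ME 0 0 (-ME))).mulVec (b k) = ∑ l, c l • b l) ∧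
      (∀ k l, ∑ s, ∑ t, b k s *
        (Matrix.fromBlocks ((κ₁ * m₁ * m₂) • GA) 0 0
          (Matrix.fromBlocks ((κ₂ * m₂) • GE) 0 0 ((κ₂ * m₁) • GE))) s t * b l t = 0) := by
  classical
  -- the transport `Θ`
  let θ₁ : K → Fin 2 → ℚ := fun k =>
    (m₁ : ℚ) • (reCoord hd hα hK k • v₀ + imCoord hd hα hK k • ME.mulVec v₀)
  let θ₂ : K → Fin 2 → ℚ := fun k =>
    (m₂ : ℚ) • (reCoord hd hα hK k • v₀ - imCoord hd hα hK k • ME.mulVec v₀)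
  have hθ₁ : ∀ k, θ₁ k = (m₁ : ℚ) • (reCoord hd hα hK k • v₀ + imCoord hd hα hK k • ME.mulVec v₀) :=
    fun _ => rfl
  have hθ₂ : ∀ k, θ₂ k = (m₂ : ℚ) • (reCoord hd hα hK k • v₀ - imCoord hd hα hK k • ME.mulVec v₀) :=
    fun _ => rfl
  let Θ : ((ιA → ℚ) × (Fin 2 → K)) →ₗ[ℚ] (ιA ⊕ (Fin 2 ⊕ Fin 2) → ℚ) :=
    { toFun := fun y => Sum.elim y.1 (Sum.elim (θ₁ (y.2 0)) (θ₂ (y.2 1)))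
      map_add' := fun y y' => by
        funext s
        rcases s with i | (j | j)
        · rfl
        · simp only [Prod.snd_add, Pi.add_apply, Sum.elim_inr, Sum.elim_inl, hθ₁, map_add]
          simp only [Pi.smul_apply, Pi.add_apply, smul_eq_mul]
          ring
        · simp only [Prod.snd_add, Pi.add_apply, Sum.elim_inr, hθ₂, map_add]
          simp only [Pi.smul_apply, Pi.sub_apply, smul_eq_mul]
          ring
      map_smul' := fun q y => by
        funext s
        rcases s with i | (j | j)
        · rfl
        · simp only [Prod.smul_snd, Pi.smul_apply, Sum.elim_inr, Sum.elim_inl, hθ₁, map_smul,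
            RingHom.id_apply, smul_eq_mul, Pi.add_apply]
          ring
        · simp only [Prod.smul_snd, Pi.smul_apply, Sum.elim_inr, hθ₂, map_smul, RingHom.id_apply,
            smul_eq_mul, Pi.sub_apply]
          ring }
  have hΘ : ∀ y, Θ y = Sum.elim y.1 (Sum.elim (θ₁ (y.2 0)) (θ₂ (y.2 1))) := fun _ => rfl
  -- `Θ` is injective
  have hΘinj : Function.Injective Θ := by
    rw [← LinearMap.ker_eq_bot, LinearMap.ker_eq_bot']
    intro y hy
    rw [hΘ] at hy
    have h1 : y.1 = 0 := by
      funext i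
      exact congrFun hy (Sum.inl i)
    have h20 : θ₁ (y.2 0) = 0 := by
      funext j
      exact congrFun hy (Sum.inr (Sum.inl j))
    have h21 : θ₂ (y.2 1) = 0 := by
      funext j
      exact congrFun hy (Sum.inr (Sum.inr j))
    have hm₁0 : (m₁ : ℚ) ≠ 0 := Nat.cast_ne_zero.2 hm₁.ne'
    have hm₂0 : (m₂ : ℚ) ≠ 0 := Nat.cast_ne_zero.2 hm₂.ne'
    rw [hθ₁, smul_eq_zero, or_iff_right hm₁0] at h20
    rw [hθ₂, smul_eq_zero, or_iff_right hm₂0, sub_eq_add_neg, ← neg_smul, neg_eq_neg_one_mul] at h21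
    have k0 : y.2 0 = 0 :=
      eq_zero_of_binaryTransport_eq_zero' hd hα hK hME hv₀ 1 one_ne_zero (by rwa [one_mul])
    have k1 : y.2 1 = 0 :=
      eq_zero_of_binaryTransport_eq_zero' hd hα hK hME hv₀ (-1) (by norm_num) h21
    refine Prod.ext h1 (funext fun j => ?_)
    fin_cases j
    · exact k0
    · exact k1
  -- `Θ` intertwines `α` with `M_A ⊕ M_E ⊕ (-M_E)`
  have hΘα : ∀ y : (ιA → ℚ) × (Fin 2 → K),
      (Matrix.fromBlocks MA 0 0 (Matrix.fromBlocks ME 0 0 (-ME))).mulVec (Θ y) = Θ (α • y) := by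
    intro y
    rw [hΘ, hΘ, Matrix.fromBlocks_mulVec, Matrix.fromBlocks_mulVec]
    simp only [Matrix.zero_mulVec, add_zero, zero_add, Prod.smul_fst, Prod.smul_snd, Pi.smul_apply,
      smul_eq_mul, hαM]
    congr 1
    · funext s
      rcases s with j | j
      · simp only [Sum.elim_inl, Function.comp_def, Sum.elim_inr]
        rw [hθ₁, hθ₁, Matrix.mulVec_smul, binaryTransport_alpha_mul hd hα hK ME v₀ hME]
      · simp only [Sum.elim_inr, Function.comp_def]
        rw [hθ₂, hθ₂, Matrix.mulVec_smul, Matrix.neg_mulVec,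
          binaryTransport_alpha_mul_neg hd hα hK ME v₀ hME]
  -- `Θ` pulls the block Gram matrix back to `m₁ m₂ ·` the form of `hiso`
  have hΘG : ∀ y y' : (ιA → ℚ) × (Fin 2 → K),
      Θ y ⬝ᵥ (Matrix.fromBlocks ((κ₁ * m₁ * m₂) • GA) 0 0
          (Matrix.fromBlocks ((κ₂ * m₂) • GE) 0 0 ((κ₂ * m₁) • GE))).mulVec (Θ y') =
        (m₁ : ℚ) * m₂ * (κ₁ * (y.1 ⬝ᵥ GA.mulVec y'.1) + κ₂ * (v₀ ⬝ᵥ GE.mulVec (ME.mulVec v₀)) *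
          ((m₁ : ℚ) * (reCoord hd hα hK (y.2 0) * imCoord hd hα hK (y'.2 0) -
              imCoord hd hα hK (y.2 0) * reCoord hd hα hK (y'.2 0)) -
            (m₂ : ℚ) * (reCoord hd hα hK (y.2 1) * imCoord hd hα hK (y'.2 1) -
              imCoord hd hα hK (y.2 1) * reCoord hd hα hK (y'.2 1)))) := by
    intro y y'
    rw [hΘ, hΘ, Matrix.fromBlocks_mulVec, Matrix.fromBlocks_mulVec, sumElim_dotProduct_sumElim]
    simp only [Matrix.zero_mulVec, add_zero, zero_add, Function.comp_def, Sum.elim_inl, Sum.elim_inr]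
    rw [show (fun x => θ₁ (y'.2 0) x) = θ₁ (y'.2 0) from rfl,
      show (fun x => θ₂ (y'.2 1) x) = θ₂ (y'.2 1) from rfl, show (fun x => y'.1 x) = y'.1 from rfl,
      sumElim_dotProduct_sumElim]
    simp only [Matrix.smul_mulVec, dotProduct_smul, smul_eq_mul, hθ₁, hθ₂, Matrix.mulVec_smul,
      smul_dotProduct, dotProduct_binaryTransport hd hα hK hGEt v₀,
      dotProduct_binaryTransport_neg hd hα hK hGEt v₀]
    ring
  -- a `ℚ`-basis of `L`
  let bL := Module.finBasisOfFinrankEq ℚ (L.restrictScalars ℚ) hL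
  refine ⟨fun k => Θ (bL k : (ιA → ℚ) × (Fin 2 → K)), ?_, ?_, ?_⟩
  · exact bL.linearIndependent.map' (Θ ∘ₗ (L.restrictScalars ℚ).subtype)
      (LinearMap.ker_eq_bot.2 (hΘinj.comp Subtype.val_injective))
  · intro k
    have hmem : α • (bL k : (ιA → ℚ) × (Fin 2 → K)) ∈ L.restrictScalars ℚ := L.smul_mem α (bL k).2
    refine ⟨fun l => bL.repr ⟨_, hmem⟩ l, ?_⟩
    rw [hΘα]
    have hsum := bL.sum_repr ⟨_, hmem⟩
    have h := congrArg (fun z : L.restrictScalars ℚ => Θ (z : (ιA → ℚ) × (Fin 2 → K))) hsum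
    simp only at h
    rw [← h]
    simp only [Submodule.coe_sum, Submodule.coe_smul_of_tower, map_sum, map_smul]
  · intro k l
    have hk : ((bL k : L.restrictScalars ℚ) : (ιA → ℚ) × (Fin 2 → K)) ∈ L := (bL k).2
    have hl : ((bL l : L.restrictScalars ℚ) : (ιA → ℚ) × (Fin 2 → K)) ∈ L := (bL l).2
    have h := hΘG (bL k) (bL l)
    rw [hiso _ hk _ hl, mul_zero] at h
    rw [← h]
    simp only [dotProduct, Matrix.mulVec, Finset.mul_sum]
    refine Finset.sum_congr rfl fun s _ => Finset.sum_congr rfl fun t _ => ?_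
    ring

end Transport

/-! ### Dimension of a product of subspaces -/

/-- `dim (p × q) = dim p + dim q` for `K`-subspaces (`p.prod q ≃ p × q`). [folklore] -/
theorem finrank_submoduleProd {K M M' : Type*} [Field K] [AddCommGroup M] [Module K M] [AddCommGroup M']
    [Module K M'] [Module.Finite K M] [Module.Finite K M'] (p : Submodule K M) (q : Submodule K M') :
    Module.finrank K (p.prod q) = Module.finrank K p + Module.finrank K q := by
  let e : (p.prod q) ≃ₗ[K] (p × q) :=
    { toFun := fun x => (⟨x.1.1, (Submodule.mem_prod.1 x.2).1⟩, ⟨x.1.2, (Submodule.mem_prod.1 x.2).2⟩)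
      map_add' := fun _ _ => rfl
      map_smul' := fun _ _ => rfl
      invFun := fun y => ⟨(y.1, y.2), Submodule.mem_prod.2 ⟨y.1.2, y.2.2⟩⟩
      left_inv := fun _ => rfl
      right_inv := fun _ => rfl }
  rw [e.finrank_eq, Module.finrank_prod]

/-! ### All cases -/

/-- **Isotropic vectors for the block Gram matrix of `A × (E₀ × E₀)`, in all cases.** The conclusion of
`exists_isotropic_blockVectors` (file XI) without the non-degeneracy hypotheses `κ₁ ≠ 0`, `κ₂ ≠ 0`,
`r₀ = G_E(v₀, M_E v₀) ≠ 0` — only `v₀ ≠ 0` is kept (for the injectivity of the transport). In the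
degenerate cases `m₁ = m₂ = 1` and the Lagrangian is explicit: if `κ₂ r₀ = 0` (the partner blocks of
the Gram matrix vanish) `L = L_A × K²` with `L_A` a totally isotropic `(n-1)`-subspace of
`(V_A, E_A)` — signature `(n, n)` has Witt index `≥ n - 1` (the tree's `Motives.exists_weil_presplitting`,
van Geemen 5.4 via Meyer); if `κ₁ = 0` (the `A`-block vanishes) `L = P × K·(1,1)` with `P` a
positive `n`-subspace and the diagonal line of `K²`, isotropic for `W ⊕ -W`. Then the transport
lemma `exists_blockVectors_of_isotropicSubmodule`. [cite: vanGeemen1994HodgeAV, Lemma 5.2 (3), 5.3 and 5.4 (5.4.1)] -/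
theorem exists_isotropic_blockVectors' {d : ℚ} (hd : 0 < d) {ιA : Type} [Fintype ιA] [DecidableEq ιA]
    (MA : Matrix ιA ιA ℚ) (hMA : ∀ v, MA.mulVec (MA.mulVec v) = -(d • v))
    (GA : Matrix ιA ιA ℚ) (hGAt : ∀ x y : ιA → ℚ, y ⬝ᵥ GA.mulVec x = -(x ⬝ᵥ GA.mulVec y))
    (hWA : ∀ x y : ιA → ℚ, MA.mulVec x ⬝ᵥ GA.mulVec (MA.mulVec y) = d * (x ⬝ᵥ GA.mulVec y))
    (n : ℕ) (hcard : Fintype.card ιA = 4 * n)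
    (hPN : ∃ P N : Submodule ℚ (ιA → ℚ), (∀ v ∈ P, MA.mulVec v ∈ P) ∧ (∀ v ∈ N, MA.mulVec v ∈ N) ∧
      Module.finrank ℚ P = 2 * n ∧ Module.finrank ℚ N = 2 * n ∧ P ⊓ N = ⊥ ∧
      (∀ x ∈ P, x ≠ 0 → 0 < x ⬝ᵥ GA.mulVec (MA.mulVec x)) ∧
      (∀ x ∈ N, x ≠ 0 → x ⬝ᵥ GA.mulVec (MA.mulVec x) < 0))
    (ME : Matrix (Fin 2) (Fin 2) ℚ) (hME : ∀ v, ME.mulVec (ME.mulVec v) = -(d • v))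
    (GE : Matrix (Fin 2) (Fin 2) ℚ) (hGEt : ∀ x y : Fin 2 → ℚ, y ⬝ᵥ GE.mulVec x = -(x ⬝ᵥ GE.mulVec y))
    (v₀ : Fin 2 → ℚ) (hv₀ : v₀ ≠ 0) (κ₁ κ₂ : ℚ) :
    ∃ m₁ m₂ : ℕ, 0 < m₁ ∧ 0 < m₂ ∧
      ∃ b : Fin (2 * (n + 1)) → (ιA ⊕ (Fin 2 ⊕ Fin 2)) → ℚ, LinearIndependent ℚ b ∧
        (∀ k, ∃ c : Fin (2 * (n + 1)) → ℚ,
          (Matrix.fromBlocks MA 0 0 (Matrix.fromBlocks ME 0 0 (-ME))).mulVec (b k) = ∑ l, c l • b l) ∧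
        (∀ k l, ∑ s, ∑ t, b k s *
          (Matrix.fromBlocks ((κ₁ * m₁ * m₂) • GA) 0 0
            (Matrix.fromBlocks ((κ₂ * m₂) • GE) 0 0 ((κ₂ * m₁) • GE))) s t * b l t = 0) := by
  classical
  by_cases hgen : κ₁ ≠ 0 ∧ κ₂ ≠ 0 ∧ v₀ ⬝ᵥ GE.mulVec (ME.mulVec v₀) ≠ 0
  · exact exists_isotropic_blockVectors hd MA hMA GA hGAt hWA n hcard hPN ME hME GE hGEt v₀ hgen.2.2
      κ₁ κ₂ hgen.1 hgen.2.1
  -- degenerate cases: `m₁ = m₂ = 1`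
  have hdeg : κ₂ * (v₀ ⬝ᵥ GE.mulVec (ME.mulVec v₀)) = 0 ∨ κ₁ = 0 := by
    simp only [not_and_or, not_not, Ne] at hgen
    rcases hgen with h | h | h
    · exact Or.inr h
    · exact Or.inl (by rw [h, zero_mul])
    · exact Or.inl (by rw [h, mul_zero])
  refine ⟨1, 1, one_pos, one_pos, ?_⟩
  -- the quadratic algebra and the `K`-structure on `V = ι_A → ℚ` (as in file XI)
  obtain ⟨K, _, _, α, hα, hK⟩ := exists_quadraticField d hd
  haveI : Module.Finite ℚ K := Module.Finite.of_basis (basisOneAlpha hd hα hK)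
  obtain ⟨inst, hinst⟩ := exists_module_smul_eq (V := ιA → ℚ) hd hα hK (Matrix.mulVecLin MA)
    (fun v => by rw [Matrix.mulVecLin_apply, Matrix.mulVecLin_apply]; exact hMA v)
  letI : Module K (ιA → ℚ) := inst
  haveI : IsScalarTower ℚ K (ιA → ℚ) := hinst.1
  have hαM : ∀ v : ιA → ℚ, α • v = MA.mulVec v := fun v => by rw [hinst.2 v, Matrix.mulVecLin_apply]
  haveI : Module.Finite K (ιA → ℚ) := Module.Finite.of_restrictScalars_finite ℚ K (ιA → ℚ)
  have hV : Module.finrank K (ιA → ℚ) = 2 * n := by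
    have h := two_mul_finrank_eq_of_weilOperator (V := ιA → ℚ) hd hα hK
    rw [Module.finrank_fintype_fun_eq_card, hcard] at h
    omega
  set E : LinearMap.BilinForm ℚ (ιA → ℚ) := Matrix.toBilin' GA with hEdef
  have hEapp : ∀ x y : ιA → ℚ, E x y = x ⬝ᵥ GA.mulVec y := fun x y => Matrix.toBilin'_apply' GA x y
  have hE : ∀ x y : ιA → ℚ, E x y = -E y x := fun x y => by rw [hEapp, hEapp, hGAt]
  have hW : ∀ x y : ιA → ℚ, E (α • x) (α • y) = d * E x y := fun x y => by
    rw [hEapp, hEapp, hαM, hαM, hWA]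
  have hPN' : ∃ P N : Submodule K (ιA → ℚ), Module.finrank K P = n ∧ Module.finrank K N = n ∧
      P ⊓ N = ⊥ ∧ (∀ x ∈ P, x ≠ 0 → 0 < E x (α • x)) ∧ (∀ x ∈ N, x ≠ 0 → E x (α • x) < 0) := by
    obtain ⟨P, N, hP, hN, hPf, hNf, hPN0, hpos, hneg⟩ := hPN
    obtain ⟨P', hP'⟩ := exists_restrictScalars_eq_of_stable hd hα hK (Matrix.mulVecLin MA)
      hinst.2 P (fun v hv => by simpa using hP v hv)
    obtain ⟨N', hN'⟩ := exists_restrictScalars_eq_of_stable hd hα hK (Matrix.mulVecLin MA)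
      hinst.2 N (fun v hv => by simpa using hN v hv)
    refine ⟨P', N', ?_, ?_, inf_eq_bot_of_restrictScalars (by rw [hP', hN', hPN0]), ?_, ?_⟩
    · have h := two_mul_finrank_submodule_eq (V := ιA → ℚ) hd hα hK P'
      rw [hP', hPf] at h
      omega
    · have h := two_mul_finrank_submodule_eq (V := ιA → ℚ) hd hα hK N'
      rw [hN', hNf] at h
      omega
    · intro x hx hx0
      have hx' : x ∈ P := by rw [← hP']; exact hx
      rw [hEapp, hαM]
      exact hpos x hx' hx0
    · intro x hx hx0
      have hx' : x ∈ N := by rw [← hN']; exact hx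
      rw [hEapp, hαM]
      exact hneg x hx' hx0
  -- an isotropic `K`-subspace `L` of dimension `n + 1` for the degenerate form
  have hL : ∃ L : Submodule K ((ιA → ℚ) × (Fin 2 → K)), Module.finrank K L = n + 1 ∧
      ∀ x ∈ L, ∀ y ∈ L, κ₁ * (x.1 ⬝ᵥ GA.mulVec y.1) + κ₂ * (v₀ ⬝ᵥ GE.mulVec (ME.mulVec v₀)) *
        (((1 : ℕ) : ℚ) * (reCoord hd hα hK (x.2 0) * imCoord hd hα hK (y.2 0) -
            imCoord hd hα hK (x.2 0) * reCoord hd hα hK (y.2 0)) -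
          ((1 : ℕ) : ℚ) * (reCoord hd hα hK (x.2 1) * imCoord hd hα hK (y.2 1) -
            imCoord hd hα hK (x.2 1) * reCoord hd hα hK (y.2 1))) = 0 := by
    rcases hdeg with hκr | hκ
    · -- the partner blocks vanish: `L = L_A × K²`, `L_A` totally isotropic of dimension `n - 1`
      rcases Nat.eq_zero_or_pos n with hn0 | hn
      · -- `n = 0`: `L = 0 × K·e₀`
        refine ⟨(⊥ : Submodule K (ιA → ℚ)).prod (K ∙ (Pi.single 0 1 : Fin 2 → K)), ?_, ?_⟩
        · rw [finrank_submoduleProd, finrank_bot, finrank_span_singleton (by simp), hn0]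
        · intro x hx y hy
          rw [(Submodule.mem_bot K).1 (Submodule.mem_prod.1 hx).1, zero_dotProduct, mul_zero, zero_add,
            hκr, zero_mul]
      · obtain ⟨LA, -, -, hLAf, hLL, -⟩ :=
          exists_weil_presplitting hd hα hK n hn (ιA → ℚ) hV E hE hW hPN'
        refine ⟨LA.prod ⊤, ?_, ?_⟩
        · rw [finrank_submoduleProd, finrank_top, Module.finrank_fintype_fun_eq_card, Fintype.card_fin]
          omega
        · intro x hx y hy
          have h0 : x.1 ⬝ᵥ GA.mulVec y.1 = 0 := by
            rw [← hEapp]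
            exact apply_eq_zero_of_weilHermitianForm_eq_zero E hd hα
              (hLL x.1 (Submodule.mem_prod.1 hx).1 y.1 (Submodule.mem_prod.1 hy).1)
          rw [h0, mul_zero, zero_add, hκr, zero_mul]
    · -- the `A`-block vanishes: `L = P × K·(1,1)`
      obtain ⟨P, -, hPf, -, -, -, -⟩ := hPN'
      refine ⟨P.prod (K ∙ (fun _ => 1 : Fin 2 → K)), ?_, ?_⟩
      · rw [finrank_submoduleProd, hPf, finrank_span_singleton]
        exact fun h => one_ne_zero (congrFun h 0)
      · intro x hx y hy
        obtain ⟨cx, hcx⟩ := Submodule.mem_span_singleton.1 (Submodule.mem_prod.1 hx).2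
        obtain ⟨cy, hcy⟩ := Submodule.mem_span_singleton.1 (Submodule.mem_prod.1 hy).2
        have hx01 : x.2 0 = x.2 1 := by rw [← hcx]; rfl
        have hy01 : y.2 0 = y.2 1 := by rw [← hcy]; rfl
        rw [hκ, hx01, hy01]
        ring
  obtain ⟨L, hLf, hLiso⟩ := hL
  haveI : Module.Finite ℚ (L.restrictScalars ℚ) := Module.Finite.of_injective
    (L.restrictScalars ℚ).subtype Subtype.val_injective
  have hLℚ : Module.finrank ℚ (L.restrictScalars ℚ) = 2 * (n + 1) := by
    have h := two_mul_finrank_submodule_eq (V := (ιA → ℚ) × (Fin 2 → K)) hd hα hK L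
    rw [hLf] at h
    omega
  exact exists_blockVectors_of_isotropicSubmodule hd hα hK MA GA hαM ME GE hME hGEt hv₀ one_pos one_pos
    κ₁ κ₂ n L hLℚ hLiso

end Literature.AlgebraicGeometry.Motives

end
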